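import Mathlib
import Literature.Computability.Complexity.RangeAvoidance
import Literature.Computability.Complexity.SignDegreeXor
import HarnessLib.Audit

/-!
# Isolation of the all-ones range point of a pure `P⋆` local map — the flip inequality (K1)

FRONTIER range-avoidance ladder, rung F-N3 (pure `P⋆` maps `y_j = x_{a_j} ⊕ x_{b_j} ⊕ x_{c_j}·x_{d_j}` at linear
stretch; restricted-model algorithmics — nothing here bears on `P` vs `NP`).  Cell `pnp-ideate`, ROUND-19, mechanism M19.

The all-ones input is FULLY SENSITIVE for `P⋆ = xorAndPred` (`P⋆(1,1,1,1) = 1` and every single-slot flip changes the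
value), and `C(1ⁿ) = 1ᵐ`.  Write an input as `x = 1 − 1_U` (`gauge U`).  Output `j` flips (relative to `1ᵐ`) iff
`[#XOR slots of j in U = 1] ⊕ [#AND slots of j in U ≥ 1]`.  Summing a nine-case per-output inequality gives the
**flip inequality**
`6·volA(U) + 10·eL(U) ≤ 6·|Ψ(U)| + 6·eA(U) + 5·volL(U) + eLA(U)`,
where `Ψ(U)` is the set of flipped outputs, `volL/volA` count XOR/AND slots inside `U`, `eL/eA` count outputs with both
XOR (resp. both AND) slots inside `U`, and `eLA = Σ_j tL_j·tA_j`.  Under spectral pseudo-randomness of the XOR graph, the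
AND graph and the XOR–AND co-occurrence graph the right-hand sides are controlled by expander mixing and the inequality
forces `|Ψ(U)| ≥ |U|·(C/3)(1 − 11η − 9κ/√C) ≥ 2` for every non-empty `U` once `C = m/n` is large: no input lands at
Hamming distance exactly `1` from `1ᵐ`, so the string `0·1^{m−1}` avoids the range (files `PstarIsolationBound`,
`PstarIsolationFP`).  This file: the objects, the statements K1/K1′ with their proofs (`flipInequality`,
`flipOfPreimage`, `support_nonempty_of_preimage`), and the OPEN roof `PstarAvoidLinearFP` of rung F-N3.
-/

set_option linter.dupNamespace false

open Finset Literature.Computability.Complexity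

namespace Summit.PneNP.PneNP.Theorems.PstarIsolation

variable {n m : ℕ}

/-! ## The objects -/

/-- The Hamming neighbour `1ᵐ ⊕ e_i` of the all-ones output string. -/
def onesFlip (i : Fin m) : Fin m → Bool := Function.update (fun _ => true) i false

/-- The input `1 − 1_U`. -/
def gauge (U : Finset (Fin n)) : Fin n → Bool := fun v => decide (v ∉ U)

/-- `Ψ(U)`: the outputs that are `false` (flipped relative to `1ᵐ`) at the input `gauge U`. -/
def flipped (I : LocalMap 4 n m) (U : Finset (Fin n)) : Finset (Fin m) :=
  univ.filter fun j => I.eval (gauge U) j = false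

/-- Indicator of `v ∈ U` as a natural number. -/
def inU (U : Finset (Fin n)) (v : Fin n) : ℕ := if v ∈ U then 1 else 0

/-- Number of XOR slots (slots `0,1` of `xorAndPred`) of output `j` inside `U`. -/
def tL (I : LocalMap 4 n m) (U : Finset (Fin n)) (j : Fin m) : ℕ := inU U (I.vars j 0) + inU U (I.vars j 1)

/-- Number of AND slots (slots `2,3`) of output `j` inside `U`. -/
def tA (I : LocalMap 4 n m) (U : Finset (Fin n)) (j : Fin m) : ℕ := inU U (I.vars j 2) + inU U (I.vars j 3)

/-- `volL(U)`: XOR slots inside `U` (the volume of `U` in the XOR multigraph `G_L`). -/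
def volL (I : LocalMap 4 n m) (U : Finset (Fin n)) : ℕ := ∑ j, tL I U j

/-- `volA(U)`: AND slots inside `U`. -/
def volA (I : LocalMap 4 n m) (U : Finset (Fin n)) : ℕ := ∑ j, tA I U j

/-- `eL(U)`: outputs with both XOR slots inside `U` (edges of `G_L` inside `U`). -/
def eL (I : LocalMap 4 n m) (U : Finset (Fin n)) : ℕ := (univ.filter fun j => tL I U j = 2).card

/-- `eA(U)`: outputs with both AND slots inside `U`. -/
def eA (I : LocalMap 4 n m) (U : Finset (Fin n)) : ℕ := (univ.filter fun j => tA I U j = 2).card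

/-- `eLA(U) = Σ_j tL_j·tA_j`: XOR–AND slot pairs of one output both inside `U` (edges of `G_LA` inside `U`). -/
def eLA (I : LocalMap 4 n m) (U : Finset (Fin n)) : ℕ := ∑ j, tL I U j * tA I U j

/-! ## The statements -/

/-- **K1 — the flip inequality** (proved below, `flipInequality`). -/
def FlipInequality : Prop :=
  ∀ (n m : ℕ) (I : LocalMap 4 n m), I.IsPure xorAndPred → ∀ U : Finset (Fin n),
    6 * volA I U + 10 * eL I U ≤ 6 * (flipped I U).card + 6 * eA I U + 5 * volL I U + eLA I U

/-- **K1′** — a preimage of `1ᵐ ⊕ e_i` flips exactly one output (proved below, `flipOfPreimage`). -/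
def FlipOfPreimage : Prop :=
  ∀ (n m : ℕ) (I : LocalMap 4 n m) (x : Fin n → Bool) (i : Fin m), I.eval x = onesFlip i →
    (flipped I (univ.filter fun v => x v = false)).card = 1

/-- OPEN — **the roof F-N3** `PstarAvoidLinearFP` (**range avoidance at linear stretch is in FP for all pure `P⋆`
maps**, no promise; cell pnp-ideate ROUND-17/18: the residual wall of `NC⁰₄`-AVOID after the affine split, the
sign-degree-2 engine and the pair peeling `PstarPairPeelFP`).  Print decides `NC⁰₄`-AVOID in FP only from
`m ≥ c⁴ n^{3/2} log n` [cite: GuruswamiLyuYuan2025, §1].  [status: open] Users take `(h : PstarAvoidLinearFP)`. -/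
@[conjecture] def PstarAvoidLinearFP : Prop := LocalAvoidLinearFP 4 (fun _ _ I => I.IsPure xorAndPred)

/-! ## Sanity: the all-ones point -/

/-- `P⋆(1,1,1,1) = 1`. -/
theorem xorAndPred_ones : xorAndPred (fun _ : Fin 4 => true) = true := by
  rw [xorAndPred_apply]; rfl

/-- `C(1ⁿ) = 1ᵐ` for a pure `P⋆` map. -/
theorem eval_ones (I : LocalMap 4 n m) (hI : I.IsPure xorAndPred) :
    I.eval (fun _ => true) = fun _ => true := by
  funext j
  simp only [LocalMap.eval, hI.1 j]
  exact xorAndPred_ones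

/-- The gauge of the zero set of `x` is `x`. -/
theorem gauge_zeroSet (x : Fin n → Bool) : gauge (univ.filter fun v => x v = false) = x := by
  funext v
  simp only [gauge, Finset.mem_filter, Finset.mem_univ, true_and]
  cases x v <;> simp

/-- `1ᵐ ⊕ e_i` is `false` exactly at `i`. -/
theorem onesFlip_eq_false_iff (i j : Fin m) : onesFlip i j = false ↔ j = i := by
  unfold onesFlip
  by_cases h : j = i
  · subst h; simp
  · simp [h]

/-! ## K1′ — a preimage of `1ᵐ ⊕ e_i` flips exactly one output, and is not all-ones -/

/-- **K1′.** A preimage `x` of `1ᵐ ⊕ e_i` flips exactly one output: `Ψ(zero set of x) = {i}`. -/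
theorem flipped_card_of_preimage (I : LocalMap 4 n m) (x : Fin n → Bool) (i : Fin m)
    (h : I.eval x = onesFlip i) : (flipped I (univ.filter fun v => x v = false)).card = 1 := by
  rw [Finset.card_eq_one]
  refine ⟨i, ?_⟩
  ext j
  simp only [flipped, gauge_zeroSet, h, Finset.mem_filter, Finset.mem_univ, true_and, Finset.mem_singleton]
  exact onesFlip_eq_false_iff i j

/-- **K1′** as the typed statement. -/
theorem flipOfPreimage : FlipOfPreimage := fun _ _ I x i h => flipped_card_of_preimage I x i h

/-- A preimage of `1ᵐ ⊕ e_i` under a pure `P⋆` map has a non-empty zero set. -/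
theorem support_nonempty_of_preimage (I : LocalMap 4 n m) (hI : I.IsPure xorAndPred) (x : Fin n → Bool)
    (i : Fin m) (h : I.eval x = onesFlip i) : (univ.filter fun v => x v = false).Nonempty := by
  by_contra hU
  rw [Finset.not_nonempty_iff_eq_empty] at hU
  have hx : x = fun _ => true := by
    funext v
    by_contra hv
    have : v ∈ (univ.filter fun v => x v = false) := by
      simp only [Finset.mem_filter, Finset.mem_univ, true_and]
      simpa using hv
    rw [hU] at this
    simp at this
  have := congrFun h i
  rw [hx, eval_ones I hI] at this
  simp [onesFlip] at this

/-! ## K1 — the flip inequality -/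

/-- The value of output `j` at the input `gauge U`. -/
theorem eval_gauge (I : LocalMap 4 n m) (hI : I.IsPure xorAndPred) (U : Finset (Fin n)) (j : Fin m) :
    I.eval (gauge U) j =
      xor (xor (decide (I.vars j 0 ∉ U)) (decide (I.vars j 1 ∉ U)))
        (decide (I.vars j 2 ∉ U) && decide (I.vars j 3 ∉ U)) := by
  simp only [LocalMap.eval, hI.1 j, xorAndPred_apply, gauge]

/-- The nine-case per-output inequality (sixteen slot patterns). -/
theorem per_output (I : LocalMap 4 n m) (hI : I.IsPure xorAndPred) (U : Finset (Fin n)) (j : Fin m) :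
    6 * tA I U j + 10 * (if tL I U j = 2 then 1 else 0) ≤
      6 * (if I.eval (gauge U) j = false then 1 else 0) + 6 * (if tA I U j = 2 then 1 else 0) +
        5 * tL I U j + tL I U j * tA I U j := by
  rw [eval_gauge I hI U j]
  unfold tL tA inU
  by_cases h0 : I.vars j 0 ∈ U <;> by_cases h1 : I.vars j 1 ∈ U <;> by_cases h2 : I.vars j 2 ∈ U <;>
    by_cases h3 : I.vars j 3 ∈ U <;> simp [h0, h1, h2, h3]

/-- **K1.** The flip inequality. -/
theorem flipInequality : FlipInequality := by
  intro n m I hI U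
  have hflip : (flipped I U).card = ∑ j, (if I.eval (gauge U) j = false then 1 else 0) := by
    unfold flipped; rw [Finset.card_filter]
  have heL : eL I U = ∑ j, (if tL I U j = 2 then 1 else 0) := by unfold eL; rw [Finset.card_filter]
  have heA : eA I U = ∑ j, (if tA I U j = 2 then 1 else 0) := by unfold eA; rw [Finset.card_filter]
  calc 6 * volA I U + 10 * eL I U
      = ∑ j, (6 * tA I U j + 10 * (if tL I U j = 2 then 1 else 0)) := by
        rw [heL]; unfold volA; rw [Finset.sum_add_distrib, Finset.mul_sum, Finset.mul_sum]
    _ ≤ ∑ j, (6 * (if I.eval (gauge U) j = false then 1 else 0) + 6 * (if tA I U j = 2 then 1 else 0) +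
          5 * tL I U j + tL I U j * tA I U j) := Finset.sum_le_sum fun j _ => per_output I hI U j
    _ = 6 * (flipped I U).card + 6 * eA I U + 5 * volL I U + eLA I U := by
        rw [hflip, heA]; unfold volL eLA
        rw [Finset.sum_add_distrib, Finset.sum_add_distrib, Finset.sum_add_distrib, Finset.mul_sum,
          Finset.mul_sum, Finset.mul_sum]

end Summit.PneNP.PneNP.Theorems.PstarIsolation
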